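import Summits.QuantumFields.BalabanUV.Beta.D1BFx.PackedKernelSplit
import Summits.QuantumFields.BalabanUV.Beta.KernelWardRelative

/-!
# `BalabanUV.Beta.D1BFx.RankOneBubble` — road «BF-x» for binder row D1, slot (K), END row `hGrp gN` (the needle group), «GN-𝔅»: THE RANK-ONE
# BUBBLE FACTORISATION — the two-leg bubble of two RANK-ONE bond kernels is the PRODUCT OF TWO PAIRINGS,
# `biBubble A (φ ⊗ ψ) B (φ′ ⊗ ψ′) = ⟨ψ, B φ′⟩ · ⟨A φ, ψ′⟩`, hypothesis-free; and its `D = 4` instances for the gauge-term stencils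
# `dSw (f ⊗ g) = ∇f ⊗ ∇g`, `dJetSw κ u Y = (∇Y(·,u+e_κ)) ⊗ δ_{(u,κ)} − δ_{(u,κ)} ⊗ (∇Y(u+e_κ,·))` — the frame («the one structural move» of an3-g57's
# T₃ ledger `N36-SPLIT.v1.md` §3′ (1)) in which the needle-potential letters (GN-L3) and the lattice HLS kit (GN-L5) bound the gluon needle rows T₁∕T₂∕T₃

HONEST DEPENDENCY (cell records, verbatim): «continuum YM on T⁴ ⇐ BetaPertH ∧ nine spine estimates (0/9 proved); BetaPertH ⇐ (D1) ∧ (D4) ∧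
CAP+tail; G-an2-4 gates asym, D1 and NE2/3/4.»  HONEST FRAMING (cell contract, verbatim): «discharging `BetaPertH` makes Bałaban's UV stability
UNCONDITIONAL — a real constructive-QFT result; it is NOT the continuum limit and NOT the Clay problem.»  THIS MODULE DISCHARGES NOTHING of the
wall: definitions with bodies ([our objects] `outer`, `applyK`, `applyKT`, `pairing`, the localisation class `LocV` — a PREDICATE on bond functions like
`TameKernelCalculus.Loc`, never a fact —, `grad`, `bondInd`, `colGrad`, `rowGrad`) and [folklore] algebra of lattice series in which ONLY the
unconditional scalar pull-outs `tsum_mul_left` ∕ `tsum_mul_right` ∕ `Finset.mul_sum` and `tsum_eq_single` are used (no Fubini, no summability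
hypothesis) — plus the tree's `bubble_add_left∕right`, `bubble_sub_left` (TameKernelCalculus ∕ KernelWardRelative, under `Spr`∕`Loc`) for the split
forms of §4.  No `def … : Prop` FACT, nothing cited, 0 sorry.  Asserts NO bound on any table.  Root-level binders hW ∕ hR-sockets ∕ hSX-socket ∕
D1Tel ∕ D1Rep — 0 discharged; (K) NOT closed; NOT D1, NOT `BetaPertH`, NOT continuum, NOT Clay.

ABSOLUTE RULE (cell charter, verbatim): «No internally-minted statement may enter as a cited fact. Every hypothesis is either kernel-proved in
this package or a verbatim quotation of a PUBLISHED theorem with page reference. The manuscript(s) under audit are NOT citable for their own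
disputed steps — they are the thing under adjudication; programme-internal (2001/route/tribunal) claims are never citable.»

WHY (owner records `HOME/b2b-balaban-beta-d1-p2/GLUON-NEEDLE-ROWS.md` v0.1 + RULING ρ-g9-33; an3-g57 `N36-SPLIT.v1.md` §3′ (1): «THE ONE STRUCTURAL
MOVE (exact, summation by parts twice; `dSw_rankOne`∕`dSw_antisym_pair`): for `Y = Σ_j a_j⊗b_j`, `Y′ = Σ_i a′_i⊗b′_i` (site functions),
`tr((Ga∘dSw Y′)∘(Ga∘dSw Y)) = Σ_{i,j} 𝔅(b′_i, a_j)·𝔅(b_j, a′_i)`, `𝔅(f,h) := ⟨∇f, Ga ∇h⟩` … So T₃ is a finite sum of products of the bilinear form 𝔅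
between the six building-block functions `C, row, RG(·,u), δρ, P(u,·), δp` of the two bonds»).  The gluon needle rows T₁∕T₂∕T₃ of
`NeedleRowGlue.abs_gN_row_le_of_tables` pair the gluon leg `Ga` with the projector sector `SbRblk = cK • dipPiece + ndlPiece − projPiece`
(`GluonNeedleSplit.SbRblk_eq_pieces`), and `SbRblkAnatomy.SbRblk_apply_road` displays `Rdot = cK·(ρ′⊗p − ρ⊗p′ − p⊗ρ′ + p′⊗ρ) − row⊗C + C⊗row`:
every piece is a signed sum of `dSw` of TENSOR PRODUCTS of site functions, and the projector jet `dJetSw κ u (Pgt)` is a difference of two tensor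
products one of whose factors is the bond indicator.  This file proves, once, that the bubble of two such rank-one bond kernels FACTORISES into two
pairings (§1, any dimension, any fibre, NO hypothesis), records the localisation bookkeeping under which the tree's additivity lemmas split the
sums (§2), and instantiates at `D = 4` (§3–§4): after it, each of the R1∕R2∕R3 words of §3′ (4) is LITERALLY a product `⟨∇h, Ga ∇f⟩·⟨∇h′, Ga ∇f′⟩`
(or a point value `(Ga ∇f)(u,κ)`, or an entry of `Ga`, when a bond indicator is paired), and the letters (L1)–(L5) bound the factors.

CONTENT.
* §1 (any `D`, `F`) [our objects] `outer φ ψ x z a b := φ x a · ψ z b`, `applyK A φ x a := Σ'_y Σ_b A x y a b · φ y b`, `applyKT ψ A z b :=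
  Σ'_y Σ_a ψ y a · A y z a b`, `pairing ψ χ := Σ'_x Σ_a ψ x a · χ x a`; [folklore] `comp_outer_right`, `comp_outer_left`, `comp_outer_outer`,
  `tr_outer`, **`biBubble_outer_outer`** (hypothesis-free), `bubble_outer_outer`; the linear structure of `outer`.
* §2 [our object] the class `LocV φ :↔ ∃ p C δ > 0, |φ x a| ≤ C e^{−δ|x−p|₁}`; [folklore] closure (`add`, `sub`, `neg`, `smul`, `finset_sum`), columns ∕
  rows of a spread kernel (`locV_col_of_decays`, `locV_row_of_decays`), **`loc_outer`** (`LocV φ → LocV ψ → Loc (outer φ ψ)`), and the split lemmas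
  `bubble_outer_sub_left∕right` over a spread leg.
* §3 (`D = 4`) [our objects] `grad f x α := f (x + e_α) − f x`, `bondInd κ u z β := [z = u ∧ β = κ]`, `colGrad Y q x α := Y (x+e_α) q − Y x q`,
  `rowGrad Y p z β := Y p (z+e_β) − Y p z`; [folklore] **`dSw_tensor`** (`dSw (f ⊗ g) = outer (grad f) (grad g)`), **`dJetSw_eq_outer_sub`**,
  `pairing_bondInd_left∕right`, `applyK_bondInd`, `applyKT_bondInd` (evaluation at the bond), `locV_grad`, `locV_bondInd`.
* §4 [folklore] the word shapes: **`biBubble_dSw_dSw`** (`= ⟨∇g, B ∇f′⟩·⟨A ∇f, ∇g′⟩`), `biBubble_dSw_outer_bondInd_left∕right` (one factor the bond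
  indicator ⇒ a point value), for ANY legs `A`, `B` with no hypothesis; the consumer expands `dJetSw` ∕ sums of tensors with §2 + the tree's
  `bubble_add_left∕right` ∕ `bubble_sub_left` ∕ `GluonNeedleSplit.bubble_sub_right` ∕ `bubble_smul_left∕right`.
NOT HERE (honest): any estimate; the identification of `row`, `C`, `D` (that is `SbRblk_apply_road`); the `q̄∕q°` split; Ward letters.
Unit `b2b-balaban-beta-d1-p2` (gen 10), road «BF-x» OWNER; `LEAVES-BFx.md` row (N) «GN-𝔅».
-/

noncomputable section

namespace Summit.QuantumFields.BalabanUV.Beta.D1BFx.RankOneBubble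

open Finset
open scoped BigOperators
open Literature.MathematicalPhysics.QuantumFieldTheory.Balaban1983to89
open Literature.MathematicalPhysics.QuantumFieldTheory.Balaban1983to89.Beta
open B12Sec2to5 (l1 l1_nonneg)
open ExpKernelCalculus (Site MKer Decays BiLoc comp tr bubble l1_sub_triangle l1_sub_symm)
open KernelReflection (comp_smul_left comp_smul_right tr_smul bubble_smul_left bubble_smul_right)
open Summit.QuantumFields.BalabanUV.Beta.TameKernelCalculus (Spr Loc bubble_add_left bubble_add_right)
open Summit.QuantumFields.BalabanUV.Beta.KernelWardRelative (bubble_sub_left)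
open Summit.QuantumFields.BalabanUV.Beta.D1BFx.PackedKernelSplit (biBubble bubble_eq_biBubble)

variable {D : ℕ} {F : Type*} [Fintype F]

/-! ## §1 Rank-one bond kernels: the bubble of two of them is a product of two pairings (no hypothesis) -/

omit [Fintype F] in
/-- [our object] THE RANK-ONE BOND KERNEL `φ ⊗ ψ`: `outer φ ψ (x,a) (z,b) = φ x a · ψ z b`.  A definition; asserts nothing. -/
def outer (φ ψ : Site D → F → ℝ) : MKer D F := fun x z a b => φ x a * ψ z b

/-- [our object] THE LEFT ACTION of a kernel on a bond function: `(A φ)(x,a) = Σ'_y Σ_b A x y a b · φ y b`.  A definition. -/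
def applyK (A : MKer D F) (φ : Site D → F → ℝ) : Site D → F → ℝ := fun x a => ∑' y : Site D, ∑ b, A x y a b * φ y b

/-- [our object] THE RIGHT ACTION: `(ψ A)(z,b) = Σ'_y Σ_a ψ y a · A y z a b`.  A definition. -/
def applyKT (ψ : Site D → F → ℝ) (A : MKer D F) : Site D → F → ℝ := fun z b => ∑' y : Site D, ∑ a, ψ y a * A y z a b

/-- [our object] THE PAIRING of two bond functions: `⟨ψ, χ⟩ = Σ'_x Σ_a ψ x a · χ x a`.  A definition. -/
def pairing (ψ χ : Site D → F → ℝ) : ℝ := ∑' x : Site D, ∑ a, ψ x a * χ x a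

omit [Fintype F] in
/-- [our object] Unfolding `outer`. -/
@[simp] theorem outer_apply (φ ψ : Site D → F → ℝ) (x z : Site D) (a b : F) : outer φ ψ x z a b = φ x a * ψ z b := rfl

/-- [our object] Unfolding `applyK`. -/
theorem applyK_apply (A : MKer D F) (φ : Site D → F → ℝ) (x : Site D) (a : F) :
    applyK A φ x a = ∑' y : Site D, ∑ b, A x y a b * φ y b := rfl

/-- [our object] Unfolding `applyKT`. -/
theorem applyKT_apply (ψ : Site D → F → ℝ) (A : MKer D F) (z : Site D) (b : F) :
    applyKT ψ A z b = ∑' y : Site D, ∑ a, ψ y a * A y z a b := rfl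

/-- [our object] Unfolding `pairing`. -/
theorem pairing_def (ψ χ : Site D → F → ℝ) : pairing ψ χ = ∑' x : Site D, ∑ a, ψ x a * χ x a := rfl

/-- [folklore] The pairing is symmetric. -/
theorem pairing_comm (ψ χ : Site D → F → ℝ) : pairing ψ χ = pairing χ ψ := by
  unfold pairing
  exact tsum_congr fun x => Finset.sum_congr rfl fun a _ => mul_comm _ _

/-- [folklore] **A LEG ACTING ON A RANK-ONE KERNEL FROM THE LEFT**: `A ∘ (φ ⊗ ψ) = (A φ) ⊗ ψ` (only `tsum_mul_right`). -/
theorem comp_outer_right (A : MKer D F) (φ ψ : Site D → F → ℝ) : comp A (outer φ ψ) = outer (applyK A φ) ψ := by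
  funext x z a b
  show (∑' y : Site D, ∑ f, A x y a f * (φ y f * ψ z b)) = (∑' y : Site D, ∑ f, A x y a f * φ y f) * ψ z b
  rw [← tsum_mul_right]
  refine tsum_congr fun y => ?_
  rw [Finset.sum_mul]
  exact Finset.sum_congr rfl fun f _ => by ring

/-- [folklore] **A LEG ACTING ON A RANK-ONE KERNEL FROM THE RIGHT**: `(φ ⊗ ψ) ∘ B = φ ⊗ (ψ B)` (only `tsum_mul_left`). -/
theorem comp_outer_left (φ ψ : Site D → F → ℝ) (B : MKer D F) : comp (outer φ ψ) B = outer φ (applyKT ψ B) := by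
  funext x z a b
  show (∑' y : Site D, ∑ f, φ x a * ψ y f * B y z f b) = φ x a * ∑' y : Site D, ∑ f, ψ y f * B y z f b
  rw [← tsum_mul_left]
  refine tsum_congr fun y => ?_
  rw [Finset.mul_sum]
  exact Finset.sum_congr rfl fun f _ => by ring

/-- [folklore] **TWO RANK-ONE KERNELS COMPOSE TO A RANK-ONE KERNEL**: `(a ⊗ b) ∘ (c ⊗ d) = ⟨b, c⟩ • (a ⊗ d)`. -/
theorem comp_outer_outer (a b c d : Site D → F → ℝ) : comp (outer a b) (outer c d) = pairing b c • outer a d := by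
  funext x z α β
  show (∑' y : Site D, ∑ f, a x α * b y f * (c y f * d z β)) = (∑' y : Site D, ∑ f, b y f * c y f) * (a x α * d z β)
  rw [← tsum_mul_right]
  refine tsum_congr fun y => ?_
  rw [Finset.sum_mul]
  exact Finset.sum_congr rfl fun f _ => by ring

/-- [folklore] **THE TRACE OF A RANK-ONE KERNEL IS THE PAIRING OF ITS FACTORS**: `tr (a ⊗ d) = ⟨a, d⟩`. -/
theorem tr_outer (a d : Site D → F → ℝ) : tr (outer a d) = pairing a d := rfl

/-- [folklore] **THE RANK-ONE BUBBLE FACTORISATION (two legs), HYPOTHESIS-FREE**: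
`biBubble A (φ ⊗ ψ) B (φ′ ⊗ ψ′) = tr ((A∘(φ⊗ψ)) ∘ (B∘(φ′⊗ψ′))) = ⟨ψ, B φ′⟩ · ⟨A φ, ψ′⟩`.
Every step is an unconditional scalar pull-out (`comp_outer_right` twice, `comp_outer_outer`, `tr_smul`, `tr_outer`). -/
theorem biBubble_outer_outer (A B : MKer D F) (φ ψ φ' ψ' : Site D → F → ℝ) :
    biBubble A (outer φ ψ) B (outer φ' ψ') = pairing ψ (applyK B φ') * pairing (applyK A φ) ψ' := by
  unfold biBubble
  rw [comp_outer_right, comp_outer_right, comp_outer_outer, tr_smul, tr_outer]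

/-- [folklore] **THE RANK-ONE BUBBLE FACTORISATION (one leg)**: `bubble A (φ ⊗ ψ) (φ′ ⊗ ψ′) = ⟨ψ, A φ′⟩ · ⟨A φ, ψ′⟩`. -/
theorem bubble_outer_outer (A : MKer D F) (φ ψ φ' ψ' : Site D → F → ℝ) :
    bubble A (outer φ ψ) (outer φ' ψ') = pairing ψ (applyK A φ') * pairing (applyK A φ) ψ' := by
  rw [bubble_eq_biBubble, biBubble_outer_outer]

/-! ### The linear structure of `outer` -/

omit [Fintype F] in
/-- [folklore] `(φ₁ + φ₂) ⊗ ψ = φ₁ ⊗ ψ + φ₂ ⊗ ψ`. -/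
theorem outer_add_left (φ₁ φ₂ ψ : Site D → F → ℝ) : outer (φ₁ + φ₂) ψ = outer φ₁ ψ + outer φ₂ ψ := by
  funext x z a b; simp only [outer, Pi.add_apply]; ring

omit [Fintype F] in
/-- [folklore] `φ ⊗ (ψ₁ + ψ₂) = φ ⊗ ψ₁ + φ ⊗ ψ₂`. -/
theorem outer_add_right (φ ψ₁ ψ₂ : Site D → F → ℝ) : outer φ (ψ₁ + ψ₂) = outer φ ψ₁ + outer φ ψ₂ := by
  funext x z a b; simp only [outer, Pi.add_apply]; ring

omit [Fintype F] in
/-- [folklore] `(φ₁ − φ₂) ⊗ ψ = φ₁ ⊗ ψ − φ₂ ⊗ ψ`. -/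
theorem outer_sub_left (φ₁ φ₂ ψ : Site D → F → ℝ) : outer (φ₁ - φ₂) ψ = outer φ₁ ψ - outer φ₂ ψ := by
  funext x z a b; simp only [outer, Pi.sub_apply]; ring

omit [Fintype F] in
/-- [folklore] `φ ⊗ (ψ₁ − ψ₂) = φ ⊗ ψ₁ − φ ⊗ ψ₂`. -/
theorem outer_sub_right (φ ψ₁ ψ₂ : Site D → F → ℝ) : outer φ (ψ₁ - ψ₂) = outer φ ψ₁ - outer φ ψ₂ := by
  funext x z a b; simp only [outer, Pi.sub_apply]; ring

omit [Fintype F] in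
/-- [folklore] `(c • φ) ⊗ ψ = c • (φ ⊗ ψ)`. -/
theorem outer_smul_left (c : ℝ) (φ ψ : Site D → F → ℝ) : outer (c • φ) ψ = c • outer φ ψ := by
  funext x z a b; simp only [outer, Pi.smul_apply, smul_eq_mul]; ring

omit [Fintype F] in
/-- [folklore] `φ ⊗ (c • ψ) = c • (φ ⊗ ψ)`. -/
theorem outer_smul_right (c : ℝ) (φ ψ : Site D → F → ℝ) : outer φ (c • ψ) = c • outer φ ψ := by
  funext x z a b; simp only [outer, Pi.smul_apply, smul_eq_mul]; ring

omit [Fintype F] in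
/-- [folklore] `(−φ) ⊗ ψ = −(φ ⊗ ψ)`. -/
theorem outer_neg_left (φ ψ : Site D → F → ℝ) : outer (-φ) ψ = -outer φ ψ := by
  funext x z a b; simp only [outer, Pi.neg_apply]; ring

omit [Fintype F] in
/-- [folklore] `φ ⊗ (−ψ) = −(φ ⊗ ψ)`. -/
theorem outer_neg_right (φ ψ : Site D → F → ℝ) : outer φ (-ψ) = -outer φ ψ := by
  funext x z a b; simp only [outer, Pi.neg_apply]; ring

omit [Fintype F] in
/-- [folklore] THE TRANSPOSE of a rank-one kernel is the rank-one kernel of the swapped factors: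
`outer φ ψ z x b a = outer ψ φ x z a b`. -/
theorem outer_transpose (φ ψ : Site D → F → ℝ) (x z : Site D) (a b : F) : outer φ ψ z x b a = outer ψ φ x z a b := by
  simp only [outer]; ring

/-! ## §2 Exponentially localised bond functions: the class `LocV` and the splitting of sums of rank-one kernels -/

omit [Fintype F] in
/-- [our object] LOCALISED BOND FUNCTION: `|φ x a| ≤ C e^{−δ|x − p|₁}` for some centre `p`, constant `C` and rate `δ > 0`.  A PREDICATE on bond
functions (the rank-one analogue of `TameKernelCalculus.Loc`), never a fact. -/
def LocV (φ : Site D → F → ℝ) : Prop := ∃ (p : Site D) (C δ : ℝ), 0 < δ ∧ ∀ x a, |φ x a| ≤ C * Real.exp (-δ * l1 (x - p))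

omit [Fintype F] in
/-- [folklore] Lowering the rate and enlarging the constant of a `LocV` bound, and re-centring at any point `q`
(`|x − p|₁ ≥ |x − q|₁ − |q − p|₁`): `|φ x a| ≤ (|C| e^{δ′|q−p|₁}) · e^{−δ′|x − q|₁}` for `0 ≤ δ′ ≤ δ`. -/
theorem locV_recentre {φ : Site D → F → ℝ} {p : Site D} {C δ δ' : ℝ} (hδ' : 0 ≤ δ') (hle : δ' ≤ δ)
    (h : ∀ x a, |φ x a| ≤ C * Real.exp (-δ * l1 (x - p))) (q : Site D) (x : Site D) (a : F) :
    |φ x a| ≤ |C| * Real.exp (δ' * l1 (q - p)) * Real.exp (-δ' * l1 (x - q)) := by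
  refine (h x a).trans ?_
  have h1 : C * Real.exp (-δ * l1 (x - p)) ≤ |C| * Real.exp (-δ' * l1 (x - p)) :=
    (mul_le_mul_of_nonneg_right (le_abs_self C) (Real.exp_pos _).le).trans
      (mul_le_mul_of_nonneg_left (Real.exp_le_exp.mpr (by nlinarith [l1_nonneg (x - p)])) (abs_nonneg C))
  refine h1.trans ?_
  rw [mul_assoc, ← Real.exp_add]
  refine mul_le_mul_of_nonneg_left (Real.exp_le_exp.mpr ?_) (abs_nonneg C)
  have ht : l1 (x - q) ≤ l1 (x - p) + l1 (q - p) := by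
    have := l1_sub_triangle x p q
    rwa [l1_sub_symm p q] at this
  have hm := mul_le_mul_of_nonneg_left ht hδ'
  rw [mul_add] at hm
  linarith

omit [Fintype F] in
/-- [folklore] Two localised bond functions admit a COMMON centre and rate. -/
theorem locV_common {φ ψ : Site D → F → ℝ} (hφ : LocV φ) (hψ : LocV ψ) :
    ∃ (p : Site D) (C₁ C₂ δ : ℝ), 0 < δ ∧ 0 ≤ C₁ ∧ 0 ≤ C₂ ∧ (∀ x a, |φ x a| ≤ C₁ * Real.exp (-δ * l1 (x - p))) ∧
      ∀ x a, |ψ x a| ≤ C₂ * Real.exp (-δ * l1 (x - p)) := by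
  obtain ⟨p, C, δ, hδ, h⟩ := hφ
  obtain ⟨q, C', δ', hδ', h'⟩ := hψ
  refine ⟨p, |C| * Real.exp (min δ δ' * l1 (p - p)), |C'| * Real.exp (min δ δ' * l1 (p - q)), min δ δ', lt_min hδ hδ',
    by positivity, by positivity, fun x a => locV_recentre (lt_min hδ hδ').le (min_le_left _ _) h p x a,
    fun x a => locV_recentre (lt_min hδ hδ').le (min_le_right _ _) h' p x a⟩

omit [Fintype F] in
/-- [folklore] `LocV` is closed under addition. -/
theorem LocV.add {φ ψ : Site D → F → ℝ} (hφ : LocV φ) (hψ : LocV ψ) : LocV (φ + ψ) := by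
  obtain ⟨p, C₁, C₂, δ, hδ, -, -, h₁, h₂⟩ := locV_common hφ hψ
  refine ⟨p, C₁ + C₂, δ, hδ, fun x a => ?_⟩
  rw [Pi.add_apply, Pi.add_apply, add_mul]
  exact (abs_add_le _ _).trans (add_le_add (h₁ x a) (h₂ x a))

omit [Fintype F] in
/-- [folklore] `LocV` is closed under negation. -/
theorem LocV.neg {φ : Site D → F → ℝ} (hφ : LocV φ) : LocV (-φ) := by
  obtain ⟨p, C, δ, hδ, h⟩ := hφ
  exact ⟨p, C, δ, hδ, fun x a => by rw [Pi.neg_apply, Pi.neg_apply, abs_neg]; exact h x a⟩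

omit [Fintype F] in
/-- [folklore] `LocV` is closed under subtraction. -/
theorem LocV.sub {φ ψ : Site D → F → ℝ} (hφ : LocV φ) (hψ : LocV ψ) : LocV (φ - ψ) := by
  rw [sub_eq_add_neg]; exact hφ.add hψ.neg

omit [Fintype F] in
/-- [folklore] `LocV` is closed under scalar multiplication. -/
theorem LocV.smul (c : ℝ) {φ : Site D → F → ℝ} (hφ : LocV φ) : LocV (c • φ) := by
  obtain ⟨p, C, δ, hδ, h⟩ := hφ
  refine ⟨p, |c| * C, δ, hδ, fun x a => ?_⟩
  rw [Pi.smul_apply, Pi.smul_apply, smul_eq_mul, abs_mul, mul_assoc]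
  exact mul_le_mul_of_nonneg_left (h x a) (abs_nonneg c)

omit [Fintype F] in
/-- [folklore] The zero bond function is localised. -/
theorem locV_zero : LocV (0 : Site D → F → ℝ) :=
  ⟨0, 0, 1, one_pos, fun x a => by simp⟩

omit [Fintype F] in
/-- [folklore] `LocV` is closed under finite sums. -/
theorem LocV.finset_sum {ι : Type*} (s : Finset ι) {φ : ι → Site D → F → ℝ} (h : ∀ i ∈ s, LocV (φ i)) :
    LocV (∑ i ∈ s, φ i) := by
  classical
  induction s using Finset.induction_on with
  | empty => simpa using (locV_zero (D := D) (F := F))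
  | insert i s hi ih =>
    rw [Finset.sum_insert hi]
    exact (h i (Finset.mem_insert_self i s)).add (ih fun j hj => h j (Finset.mem_insert_of_mem hj))

omit [Fintype F] in
/-- [folklore] **A COLUMN OF A SPREAD KERNEL IS LOCALISED at the column site**: `Decays Y C δ`, `0 < δ` ⇒ `LocV (fun x a => Y x q a b)`. -/
theorem locV_col_of_decays {Y : MKer D F} {C δ : ℝ} (hY : Decays Y C δ) (hδ : 0 < δ) (q : Site D) (b : F) :
    LocV (fun x a => Y x q a b) :=
  ⟨q, C, δ, hδ, fun x a => hY x q a b⟩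

omit [Fintype F] in
/-- [folklore] **A ROW OF A SPREAD KERNEL IS LOCALISED at the row site**: `Decays Y C δ`, `0 < δ` ⇒ `LocV (fun z b => Y p z a b)`. -/
theorem locV_row_of_decays {Y : MKer D F} {C δ : ℝ} (hY : Decays Y C δ) (hδ : 0 < δ) (p : Site D) (a : F) :
    LocV (fun z b => Y p z a b) :=
  ⟨p, C, δ, hδ, fun z b => by rw [l1_sub_symm]; exact hY p z a b⟩

omit [Fintype F] in
/-- [folklore] **A RANK-ONE KERNEL WITH LOCALISED FACTORS IS A LOCALISED KERNEL**: `LocV φ → LocV ψ → Loc (outer φ ψ)` (so that the tree's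
`bubble_add_left∕right`, `bubble_sub_left`, `GluonNeedleSplit.bubble_sub_right` split sums of rank-one stencils over a spread leg). -/
theorem loc_outer {φ ψ : Site D → F → ℝ} (hφ : LocV φ) (hψ : LocV ψ) : Loc (outer φ ψ) := by
  obtain ⟨p, C, δ, hδ, h⟩ := hφ
  obtain ⟨q, C', δ', hδ', h'⟩ := hψ
  have hδ₀ : 0 < min δ δ' := lt_min hδ hδ'
  refine ⟨p, q, |C| * Real.exp (min δ δ' * l1 (p - p)) * (|C'| * Real.exp (min δ δ' * l1 (q - q))), min δ δ', hδ₀,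
    fun x z a b => ?_⟩
  have h1 := locV_recentre hδ₀.le (min_le_left δ δ') h p x a
  have h2 := locV_recentre hδ₀.le (min_le_right δ δ') h' q z b
  rw [outer_apply, abs_mul]
  calc |φ x a| * |ψ z b|
      ≤ (|C| * Real.exp (min δ δ' * l1 (p - p)) * Real.exp (-(min δ δ') * l1 (x - p))) *
          (|C'| * Real.exp (min δ δ' * l1 (q - q)) * Real.exp (-(min δ δ') * l1 (z - q))) :=
        mul_le_mul h1 h2 (abs_nonneg _) (by positivity)
    _ = |C| * Real.exp (min δ δ' * l1 (p - p)) * (|C'| * Real.exp (min δ δ' * l1 (q - q))) *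
          Real.exp (-(min δ δ') * (l1 (x - p) + l1 (z - q))) := by
        rw [show -(min δ δ') * (l1 (x - p) + l1 (z - q)) = -(min δ δ') * l1 (x - p) + -(min δ δ') * l1 (z - q) by ring,
          Real.exp_add]
        ring

/-- [folklore] `bubble A Y (Z₁ − Z₂) = bubble A Y Z₁ − bubble A Y Z₂` over a spread leg for localised stencils (the twin of
`KernelWardRelative.bubble_sub_left`; cf. `GluonNeedleSplit.bubble_sub_right` at `D = 4`). -/
theorem bubble_sub_right {A Y Z₁ Z₂ : MKer D F} (hA : Spr A) (hY : Loc Y) (h₁ : Loc Z₁) (h₂ : Loc Z₂) :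
    bubble A Y (Z₁ - Z₂) = bubble A Y Z₁ - bubble A Y Z₂ := by
  have h := bubble_add_right hA hY (h₁.sub h₂) h₂
  rw [sub_add_cancel] at h
  linarith

/-- [folklore] **SPLIT, LEFT SLOT**: `bubble A (φ₁⊗ψ₁ − φ₂⊗ψ₂) Z = ⟨…⟩ − ⟨…⟩` for localised factors, a localised partner and a spread leg. -/
theorem bubble_outer_sub_left {A Z : MKer D F} (hA : Spr A) (hZ : Loc Z) {φ₁ ψ₁ φ₂ ψ₂ : Site D → F → ℝ} (h₁ : LocV φ₁) (h₂ : LocV ψ₁)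
    (h₃ : LocV φ₂) (h₄ : LocV ψ₂) :
    bubble A (outer φ₁ ψ₁ - outer φ₂ ψ₂) Z = bubble A (outer φ₁ ψ₁) Z - bubble A (outer φ₂ ψ₂) Z :=
  bubble_sub_left hA (loc_outer h₁ h₂) (loc_outer h₃ h₄) hZ

/-- [folklore] **SPLIT, RIGHT SLOT**: `bubble A Y (φ₁⊗ψ₁ − φ₂⊗ψ₂) = … − …` for localised factors, a localised partner and a spread leg. -/
theorem bubble_outer_sub_right {A Y : MKer D F} (hA : Spr A) (hY : Loc Y) {φ₁ ψ₁ φ₂ ψ₂ : Site D → F → ℝ} (h₁ : LocV φ₁) (h₂ : LocV ψ₁)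
    (h₃ : LocV φ₂) (h₄ : LocV ψ₂) :
    bubble A Y (outer φ₁ ψ₁ - outer φ₂ ψ₂) = bubble A Y (outer φ₁ ψ₁) - bubble A Y (outer φ₂ ψ₂) :=
  bubble_sub_right hA hY (loc_outer h₁ h₂) (loc_outer h₃ h₄)

end Summit.QuantumFields.BalabanUV.Beta.D1BFx.RankOneBubble

end
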